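import Summits.CriticalPhenomena.PercolationContinuityZ3.Theorems.PercNearOneGluingNoHeavyLowerTailOneCutFiveZeroOneHalf
import Summits.CriticalPhenomena.PercolationContinuityZ3.Theorems.PercNearOneGluingAdditiveGluingTieLiftOne
import Summits.CriticalPhenomena.PercolationContinuityZ3.Theorems.PercNearOneGluingAdditiveGluingKnThm2GoodEvents
import HarnessLib

/-!
# `NoHeavyLowerTail` (stmt-CriticalPhenomena-4575) — the pocket exchange (POCKET-½) reduces to its TIED case
# (`q_a = q_b ≤ q_c`): "move the weight of the pair `s(o,a)` up to the first tie"

Support file (prover seat `prim-ineq-gen-8`, gen 5; `--supports stmt-CriticalPhenomena-4575`; memo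
`run/shared/lean/prim/prim-ineq-gen-8/FINDING-Z32-STRUCTURE.md` §2).  No definitions, no named facts, no sorries.

`μ = prodBernoulli w` on `Fin n`, observer `o`, vertices `a, b, c`, `q_v = μ(o ↔ v)`, pocket `B = C_o ∩ {a,b,c}`.
Assembly-2's (POCKET-½) (`…OneCutFiveZeroOneHalf`: `q_a ≥ ½`, `q_a ≤ q_b`, `q_a ≤ q_c` ⟹ `μ(B={a}) ≤ μ(B={b,c})`),
which carries the glued half of the `|A| = 5` one-cut rung (`OneCutFive.oneCut5_at_of_mem_of_pocketHalf`), is here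
reduced to its tied case:

* `OneCutFive.pocketHalf_of_pocketHalfTie` — **TIE REDUCTION**: it suffices to prove (POCKET-½) when the weakest
  vertex is TIED, `q_a = q_b ≤ q_c` (`q_a ≥ ½`).  Proof ("move the weight of one edge", as in Kozma–Nitzan §5.3 and
  the tree's `tieLiftOne_lift`): raise the weight `u` of the pair `e = s(o,a)`.  Every `μ_{w[e↦u]}(S)` is affine in
  `u` (`real_update_affine`); `q_a` is nondecreasing and `q_b − q_a`, `q_c − q_a` are nonincreasing (opening `e` helps
  `o ↔ b` by at most `μ(o ↮ a)`, `tieLiftOne_real_one_conn_le`); `μ(B = {a})` is nondecreasing (opening a pair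
  between two already joined vertices changes no connection, `insert_mem_openConn_iff_of_mem`) and `μ(B = {b,c})` is
  nonincreasing (it needs `o ↮ a`).  So along `u ∈ [w e, 1]` the hypotheses persist until the first tie
  `q_a = min(q_b, q_c)` (intermediate value theorem), where the tied case applies, and the margin
  `μ(B={b,c}) − μ(B={a})` only decreased on the way; if no tie occurs before `u = 1`, then at `u = 1` both sides
  vanish (`q_b = 1`).
* `OneCutFive.oneCut5_at_of_mem_of_pocketHalfTie` — hence the TIED exchange for all finite weighted graphs gives the
  `o ∈ A` half of `OneCutFive.OneCut5` (through assembly-2's `oneCut5_at_of_mem_of_pocketHalf`).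
REMARK (census, ttrl cp-tot3 2026-08-20): the tie may NOT be dropped from the symmetric reformulation — at a tie
`q_a = q_b` the exchange is equivalent to `μ(B={a}) + μ(B={b}) ≤ μ(B={a,c}) + μ(B={b,c})`, but that symmetric inequality
under the tie-free hypotheses `q_c ≥ max(q_a, q_b, 1 − q_a, 1 − q_b)` is FALSE (exact witness: the 4-cycle `o–c–a–b–o` with
weights `2/5, 9/10, 17/20, 2/5`, margin `+3/2500`).
HONEST LABEL: toward `|A| = 5` of the one-arm near-critical percolation programme (crux 4575); (POCKET-½), also at ties, is
OPEN (census-clean, ttrl n ≤ 7 exhaustive; no four-point row certificate); nothing here asserts it.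
-/

noncomputable section

namespace Summit.CriticalPhenomena.PercolationContinuityZ3.Theorems

open MeasureTheory Set Literature.Probability.LatticeModels Literature.Probability.Percolation
open scoped Classical BigOperators

namespace OneCutFive

variable {n : ℕ}

/-! ### Opening a pair between two joined vertices changes no connection -/


/-- If `o ↔ a` in `ω`, then opening the pair `s(o,a)` changes no connection event:
`insert s(o,a) ω ∈ openConn x y ↔ ω ∈ openConn x y`. [folklore] -/
theorem insert_mem_openConn_iff_of_mem {ω : BondConfig (Fin n)} {o a : Fin n}
    (hoa : ω ∈ openConn o a) (x y : Fin n) :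
    insert s(o, a) ω ∈ openConn x y ↔ ω ∈ openConn x y := by
  constructor
  · intro h
    have h' : (openGraph (insert s(o, a) ω)).Reachable x y := h
    have hoa' : (openGraph ω).Reachable o a := hoa
    have hHG : ∀ u v : Fin n, (openGraph (insert s(o, a) ω)).Adj u v →
        (openGraph ω).Adj u v ∨ (u ∈ ({o, a} : Finset (Fin n)) ∧ v ∈ ({o, a} : Finset (Fin n))) := by
      intro u v huv
      rw [openGraph_adj, Set.mem_insert_iff] at huv
      obtain ⟨h | h, hne⟩ := huv
      · right
        rw [Sym2.eq, Sym2.rel_iff'] at h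
        rcases h with ⟨rfl, rfl⟩ | ⟨rfl, rfl⟩ <;> simp
      · exact Or.inl ((openGraph_adj ω u v).2 ⟨h, hne⟩)
    obtain ⟨wk⟩ := h'
    rcases glueReach_walk_split hHG wk with h | ⟨⟨s, hs, hxs⟩, ⟨s', hs', hsy⟩⟩
    · exact h
    · -- `x ↔ s`, `s' ↔ y` in `ω` with `s, s' ∈ {o,a}`, and `o ↔ a` in `ω`
      have hss' : (openGraph ω).Reachable s s' := by
        rw [Finset.mem_insert, Finset.mem_singleton] at hs hs'
        rcases hs with rfl | rfl <;> rcases hs' with rfl | rfl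
        · exact SimpleGraph.Reachable.refl _
        · exact hoa'
        · exact hoa'.symm
        · exact SimpleGraph.Reachable.refl _
      exact (hxs.trans hss').trans hsy
  · intro h
    exact isUpperSet_openConn x y (Set.subset_insert _ ω) h

/-! ### The tie reduction for (POCKET-½) -/

/-- **Tie reduction.**  If the pocket exchange `μ(B = {a}) ≤ μ(B = {b,c})` holds whenever `q_a ≥ ½` and the weakest
vertex is TIED with one of the others (`q_a = q_b ≤ q_c`), then it holds whenever `q_a ≥ ½`, `q_a ≤ q_b`, `q_a ≤ q_c`
(assembly-2's (POCKET-½)).  Raise the weight of `s(o,a)` up to the first tie. [this work] -/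
theorem pocketHalf_of_pocketHalfTie
    (hT : ∀ (n : ℕ) (w : Sym2 (Fin n) → unitInterval) (o a b c : Fin n),
      o ≠ a → o ≠ b → o ≠ c → a ≠ b → a ≠ c → b ≠ c →
      1 / 2 ≤ (prodBernoulli w).real (openConn o a) →
      (prodBernoulli w).real (openConn o a) = (prodBernoulli w).real (openConn o b) →
      (prodBernoulli w).real (openConn o b) ≤ (prodBernoulli w).real (openConn o c) →
      (prodBernoulli w).real {ω : BondConfig (Fin n) | ω ∈ openConn o a ∧ ω ∉ openConn o b ∧ ω ∉ openConn o c} ≤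
        (prodBernoulli w).real {ω : BondConfig (Fin n) | ω ∉ openConn o a ∧ ω ∈ openConn o b ∧ ω ∈ openConn o c})
    (w : Sym2 (Fin n) → unitInterval) (o a b c : Fin n)
    (hoa : o ≠ a) (hob : o ≠ b) (hoc : o ≠ c) (hab : a ≠ b) (hac : a ≠ c) (hbc : b ≠ c)
    (hhalf : 1 / 2 ≤ (prodBernoulli w).real (openConn o a))
    (hab' : (prodBernoulli w).real (openConn o a) ≤ (prodBernoulli w).real (openConn o b))
    (hac' : (prodBernoulli w).real (openConn o a) ≤ (prodBernoulli w).real (openConn o c)) :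
    (prodBernoulli w).real {ω : BondConfig (Fin n) | ω ∈ openConn o a ∧ ω ∉ openConn o b ∧ ω ∉ openConn o c} ≤
      (prodBernoulli w).real {ω : BondConfig (Fin n) | ω ∉ openConn o a ∧ ω ∈ openConn o b ∧ ω ∈ openConn o c} := by
  -- the raised pair, the two endpoint measures and the affine interpolation
  set e : Sym2 (Fin n) := s(o, a) with he
  set Ea : Set (BondConfig (Fin n)) :=
    {ω : BondConfig (Fin n) | ω ∈ openConn o a ∧ ω ∉ openConn o b ∧ ω ∉ openConn o c} with hEa
  set Ebc : Set (BondConfig (Fin n)) :=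
    {ω : BondConfig (Fin n) | ω ∉ openConn o a ∧ ω ∈ openConn o b ∧ ω ∈ openConn o c} with hEbc
  set Ecb : Set (BondConfig (Fin n)) :=
    {ω : BondConfig (Fin n) | ω ∉ openConn o a ∧ ω ∈ openConn o c ∧ ω ∈ openConn o b} with hEcb
  set Ea' : Set (BondConfig (Fin n)) :=
    {ω : BondConfig (Fin n) | ω ∈ openConn o a ∧ ω ∉ openConn o c ∧ ω ∉ openConn o b} with hEa'
  have hEcb_eq : Ecb = Ebc := by
    ext ω; simp only [hEcb, hEbc, mem_setOf_eq]; tauto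
  have hEa'_eq : Ea' = Ea := by
    ext ω; simp only [hEa', hEa, mem_setOf_eq]; tauto
  set P0 : Set (BondConfig (Fin n)) → ℝ := (prodBernoulli (Function.update w e 0)).real with hP0
  set P1 : Set (BondConfig (Fin n)) → ℝ := (prodBernoulli (Function.update w e 1)).real with hP1
  obtain ⟨L, hL⟩ : ∃ L : Set (BondConfig (Fin n)) → ℝ → ℝ, L = fun S p => P0 S + p * (P1 S - P0 S) :=
    ⟨_, rfl⟩
  have hLp : ∀ (S : Set (BondConfig (Fin n))) (p : ℝ), p ∈ Icc (0:ℝ) 1 →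
      (prodBernoulli (Function.update w e (projIcc (0:ℝ) 1 zero_le_one p))).real S = L S p := by
    intro S p hp
    rw [hL, real_update_affine w e S hp]
  have hLw : ∀ S : Set (BondConfig (Fin n)), (prodBernoulli w).real S = L S (w e) := by
    intro S
    have h := hLp S (w e) ⟨(w e).2.1, (w e).2.2⟩
    rwa [projIcc_val zero_le_one (w e), Function.update_eq_self] at h
  -- endpoint facts at weight 1
  have hA1 : P1 (openConn o a) = 1 := by
    simp only [hP1, he]
    exact tieLiftOne_real_one_conn w hoa
  have hX1 : ∀ x : Fin n, P1 (openConn o x) ≤ P0 (openConn o x) + (1 - P0 (openConn o a)) := by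
    intro x
    have h := tieLiftOne_real_one_conn_le w a o x
    rw [Sym2.eq_swap, knThm2_openConn_comm x o, knThm2_openConn_comm a o] at h
    simpa only [hP1, hP0, he] using h
  have hEa01 : P0 Ea ≤ P1 Ea := by
    simp only [hP0, hP1, he]
    rw [tieLiftOne_real_one_eq]
    refine measureReal_mono (fun ω hω => ?_) (measure_ne_top _ _)
    simp only [mem_preimage, hEa, mem_setOf_eq] at hω ⊢
    obtain ⟨h1, h2, h3⟩ := hω
    exact ⟨(insert_mem_openConn_iff_of_mem h1 o a).2 h1,
      fun h => h2 ((insert_mem_openConn_iff_of_mem h1 o b).1 h),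
      fun h => h3 ((insert_mem_openConn_iff_of_mem h1 o c).1 h)⟩
  have hEbc1 : P1 Ebc = 0 := by
    simp only [hP1, he]
    rw [tieLiftOne_real_one_eq]
    have hempty : (fun ω : BondConfig (Fin n) => insert s(o, a) ω) ⁻¹' Ebc = ∅ := by
      refine Set.eq_empty_of_forall_notMem fun ω hω => ?_
      simp only [mem_preimage, hEbc, mem_setOf_eq] at hω
      apply hω.1
      show (openGraph (insert s(o, a) ω)).Reachable o a
      apply SimpleGraph.Adj.reachable
      rw [openGraph_adj]
      exact ⟨Set.mem_insert _ _, hoa⟩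
    rw [hempty, measureReal_empty]
  have hEbc0 : 0 ≤ P0 Ebc := measureReal_nonneg
  have hEa1le : P1 Ea ≤ 1 - P1 (openConn o b) := by
    have hsub : Ea ⊆ (openConn o b : Set (BondConfig (Fin n)))ᶜ := fun ω hω => hω.2.1
    calc P1 Ea ≤ P1 (openConn o b : Set (BondConfig (Fin n)))ᶜ := measureReal_mono hsub (measure_ne_top _ _)
      _ = 1 - P1 (openConn o b) := probReal_compl_eq_one_sub (Set.toFinite _).measurableSet
  have hB1le : P1 (openConn o b) ≤ 1 := measureReal_le_one
  -- the gap function `g(p) = min(q_b(p), q_c(p)) − q_a(p)` and its zero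
  obtain ⟨g, hg⟩ : ∃ g : ℝ → ℝ,
      g = fun p => min (L (openConn o b) p) (L (openConn o c) p) - L (openConn o a) p := ⟨_, rfl⟩
  have hgc : Continuous g := by
    rw [hg, hL]
    fun_prop
  have hg0 : 0 ≤ g (w e) := by
    rw [hg]
    simp only
    rw [← hLw, ← hLw, ← hLw]
    exact sub_nonneg.2 (le_min hab' hac')
  -- the margin `M(p) = L Ebc p − L Ea p` has nonpositive slope; the hypotheses give `M ≥ 0` at a tie
  have hslopeM : (P1 Ebc - P0 Ebc) - (P1 Ea - P0 Ea) ≤ 0 := by linarith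
  -- common final step: from `M(q) ≥ 0` at some `q ≥ w e` conclude `M(w e) ≥ 0`
  have hback : ∀ q : ℝ, (w e : ℝ) ≤ q → L Ea q ≤ L Ebc q → L Ea (w e) ≤ L Ebc (w e) := by
    intro q hq hMq
    rw [hL] at hMq ⊢
    simp only at hMq ⊢
    nlinarith [mul_nonneg (sub_nonneg.2 hq) (neg_nonneg.2 hslopeM)]
  rw [hLw Ea, hLw Ebc]
  by_cases hg1 : 0 ≤ g 1
  · -- no tie before `u = 1`: there `q_b = 1`, so both atoms vanish
    refine hback 1 (w e).2.2 ?_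
    have hb1 : 1 ≤ L (openConn o b) 1 := by
      rw [hg] at hg1
      simp only at hg1
      have ha1 : L (openConn o a) 1 = 1 := by rw [hL]; simp only; linarith [hA1]
      linarith [min_le_left (L (openConn o b) 1) (L (openConn o c) 1)]
    have hLb1 : L (openConn o b) 1 = P1 (openConn o b) := by rw [hL]; simp only; ring
    have hLEa1 : L Ea 1 = P1 Ea := by rw [hL]; simp only; ring
    have hLEbc1 : L Ebc 1 = P1 Ebc := by rw [hL]; simp only; ring
    rw [hLEa1, hLEbc1, hEbc1]
    rw [hLb1] at hb1
    have : P1 Ea ≤ 0 := by linarith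
    linarith [this]
  · -- a tie at some `q ∈ [w e, 1]`
    push Not at hg1
    obtain ⟨q, hqI, hgq⟩ : ∃ q ∈ Icc (w e : ℝ) 1, g q = 0 :=
      intermediate_value_Icc' (w e).2.2 hgc.continuousOn ⟨hg1.le, hg0⟩
    have hq01 : q ∈ Icc (0:ℝ) 1 := ⟨(w e).2.1.trans hqI.1, hqI.2⟩
    refine hback q hqI.1 ?_
    -- the weights at the tie and the values of the quantities there
    set wq := Function.update w e (projIcc (0:ℝ) 1 zero_le_one q) with hwq
    have hLq : ∀ S : Set (BondConfig (Fin n)), (prodBernoulli wq).real S = L S q := fun S => hLp S q hq01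
    rw [hg] at hgq
    simp only at hgq
    have hmin0 : min (L (openConn o b) q) (L (openConn o c) q) = L (openConn o a) q := by linarith
    have hbq : L (openConn o a) q ≤ L (openConn o b) q := hmin0 ▸ min_le_left _ _
    have hcq : L (openConn o a) q ≤ L (openConn o c) q := hmin0 ▸ min_le_right _ _
    -- `q_a` is nondecreasing: still `≥ ½` at `q`
    have hhalfq : 1 / 2 ≤ L (openConn o a) q := by
      have h0 : L (openConn o a) (w e) ≤ L (openConn o a) q := by
        rw [hL]; simp only
        have hsl : 0 ≤ P1 (openConn o a) - P0 (openConn o a) := by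
          rw [hA1]; linarith [(measureReal_le_one : P0 (openConn o a) ≤ 1)]
        nlinarith [mul_nonneg (sub_nonneg.2 hqI.1) hsl]
      rw [← hLw] at h0
      linarith
    rcases min_choice (L (openConn o b) q) (L (openConn o c) q) with hm | hm
    · -- tie with `b`
      rw [hm] at hmin0
      have happ := hT n wq o a b c hoa hob hoc hab hac hbc (by rw [hLq]; exact hhalfq)
        (by rw [hLq, hLq]; exact hmin0.symm) (by rw [hLq, hLq]; linarith)
      rw [hLq, hLq] at happ
      exact happ
    · -- tie with `c`: apply the hypothesis with `b` and `c` exchanged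
      rw [hm] at hmin0
      have happ := hT n wq o a c b hoa hoc hob hac hab hbc.symm (by rw [hLq]; exact hhalfq)
        (by rw [hLq, hLq]; exact hmin0.symm) (by rw [hLq, hLq]; linarith)
      change (prodBernoulli wq).real Ea' ≤ (prodBernoulli wq).real Ecb at happ
      rw [hEa'_eq, hEcb_eq, hLq, hLq] at happ
      exact happ

/-! ### The glued half of oneCut(5) from the tied exchange -/

/-- **The glued half of oneCut(5) from the TIED pocket exchange.**  If the exchange `μ(B={a}) ≤ μ(B={b,c})` holds on
every finite weighted graph whenever `q_a ≥ ½` and `q_a = q_b ≤ q_c`, then for `o ∈ A`, `A.card = 5`, `0 ≤ t` and all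
relay–relay cuts `≤ t`, the minority event `{1 ≤ N < E N/2}` has mass `≤ t` (tie reduction + assembly-2's
`oneCut5_at_of_mem_of_pocketHalf`). [this work] -/
theorem oneCut5_at_of_mem_of_pocketHalfTie
    (hT : ∀ (n : ℕ) (w : Sym2 (Fin n) → unitInterval) (o a b c : Fin n),
      o ≠ a → o ≠ b → o ≠ c → a ≠ b → a ≠ c → b ≠ c →
      1 / 2 ≤ (prodBernoulli w).real (openConn o a) →
      (prodBernoulli w).real (openConn o a) = (prodBernoulli w).real (openConn o b) →
      (prodBernoulli w).real (openConn o b) ≤ (prodBernoulli w).real (openConn o c) →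
      (prodBernoulli w).real {ω : BondConfig (Fin n) | ω ∈ openConn o a ∧ ω ∉ openConn o b ∧ ω ∉ openConn o c} ≤
        (prodBernoulli w).real {ω : BondConfig (Fin n) | ω ∉ openConn o a ∧ ω ∈ openConn o b ∧ ω ∈ openConn o c})
    (w : Sym2 (Fin n) → unitInterval) (A : Finset (Fin n)) (o : Fin n) (t : ℝ) (hA : A.card = 5) (ho : o ∈ A)
    (ht : 0 ≤ t) (hcut : ∀ a ∈ A, ∀ a' ∈ A, a ≠ a' → (prodBernoulli w).real (openConn a a')ᶜ ≤ t) :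
    (prodBernoulli w).real {ω : BondConfig (Fin n) |
        1 ≤ (A.filter fun a => ω ∈ openConn o a).card ∧
        ((A.filter fun a => ω ∈ openConn o a).card : ℝ) <
          (∑ a ∈ A, (prodBernoulli w).real (openConn o a)) / 2} ≤ t :=
  oneCut5_at_of_mem_of_pocketHalf (fun _ w o a b c hoa hob hoc hab hac hbc hh hle1 hle2 =>
      pocketHalf_of_pocketHalfTie hT w o a b c hoa hob hoc hab hac hbc hh hle1 hle2)
    w A o t hA ho ht hcut

end OneCutFive

end Summit.CriticalPhenomena.PercolationContinuityZ3.Theorems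

end
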